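import Literature.MathematicalPhysics.QuantumFieldTheory.OSTimeSlice
import Mathlib.MeasureTheory.Integral.IntervalIntegral.IntegrationByParts
import Mathlib.MeasureTheory.Integral.IntervalIntegral.FundThmCalculus
import HarnessLib

/-!
# Existence of the tempered time-ray boundary value of an OS time continuation

Second step of the proof of (A2) `OS1975_boundaryValue_of_timeContinuation`
(`Literature.MathematicalPhysics.QuantumFieldTheory.OSTimeContinuation`; Osterwalder–Schrader II
(1975), §IV.2, p. 289: "`W_k(h) = lim_{η⁰→0⁺} ∫ S_k(η⁰ + iξ⁰ | ξ⃗) h(ξ) dξ` satisfies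
`|W_k(h)| ≤ w_k |h|_{kt''}`", referred to Vladimirov §26). For `𝔚` continuous on the time tube,
holomorphic in the times and of OS growth we construct a continuous linear functional `T` on
`𝓢((ℝ^{1+d})ⁿ)` with `∫ 𝔚(x + itη) F(x) dx → T(F)` as `t → 0⁺` for **every** direction `η` of
the temporal cone (`exists_clm_tendsto_integral_rayC_I`), i.e. a tempered time-ray boundary value
(`HasTimeRayBoundaryValue`). The proof is Hörmander's second proof of Thm. 3.1.11/3.1.15
(*ALPDO I*, (3.1.19)–(3.1.20)) along a fixed reference direction `Y ∈ T₊`, for Schwartz (not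
compactly supported) test functions and a function holomorphic in the time variables only:

* `eq_sum_add_remainder_of_hasDerivAt` — the abstract form of (3.1.19): functions `Jₖ` on
  `[0, 1]` with `Jₖ' = −i J_{k+1}` satisfy
  `J₀(0) = ∑_{k ≤ N} (iᵏ/k!) Jₖ(1) + (i^{N+1}/N!) ∫₀¹ sᴺ J_{N+1}(s) ds` (fundamental theorem of
  calculus and `N` integrations by parts), here with
  `Jₖ(s) = ∫ 𝔚(x + i(tη + sY)) (∂_Yᵏ F)(x) dx`, whose derivative relation is the Cauchy–Riemann
  identity `hasDerivAt_integral_rayC_I_add_smul` of `OSTimeSlice`;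
* the limits `t → 0⁺` of the pieces (dominated convergence with the OS growth bounds of
  `OSTimeSlice`: uniform polynomial bounds on compact sets of heights, and the edge estimate
  `sᴺ ‖𝔚(x + i(tη + sY))‖ ≤ A (1 + ‖x‖)ᴺ` for the remainder);
* the limit functional
  `T(F) = ∑_{k ≤ N} (iᵏ/k!) ∫ 𝔚(x + iY) (∂_Yᵏ F)(x) dx + (i^{N+1}/N!) ∫₀¹ sᴺ ∫ 𝔚(x + isY) (∂_Y^{N+1} F)(x) dx ds`
  ((3.1.20)), assembled from continuous linear maps (`exists_clm_integral_mul` of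
  `SchwartzPolyKernel`, the line derivative `lineDerivOpCLM`, and the remainder functional
  `exists_clm_remainder`), which does not depend on `η`;
* consequences: `apply_eq_zero_of_forall_integral_rayC_I_eq_zero` (if all slice pairings of `F`
  vanish then `T F = 0`) and `apply_lineDerivOp_diag_eq_zero` (translation invariance of `𝔚`
  gives `T(∂_â F) = 0` for diagonal `â`).

## References

* K. Osterwalder, R. Schrader, Comm. Math. Phys. 42 (1975), §IV.2 p. 289, (4.7).
  [OsterwalderSchraderCMP1975]
* L. Hörmander, *The Analysis of Linear Partial Differential Operators I*, Thm. 3.1.11 (second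
  proof), Thm. 3.1.15, (3.1.19)–(3.1.20). [HormanderALPDO1]
* V. S. Vladimirov, *Methods of the Theory of Functions of Many Complex Variables* (1966), §26.2.
  [Vladimirov1966]
-/

noncomputable section

open MeasureTheory Filter Set Metric Complex intervalIntegral
open scoped Topology SchwartzMap LineDeriv
open Literature.MathematicalPhysics.QuantumLattice Literature.Analysis.FunctionSpaces

namespace Literature.MathematicalPhysics.QuantumFieldTheory

variable {d n : ℕ}

/-! ### Hörmander's formula (3.1.19), abstract form -/

/-- **Hörmander's formula (3.1.19)**: if `Jₖ : ℝ → ℂ` satisfy `Jₖ' = −i J_{k+1}` on `[0, 1]` then,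
for every `N`, `J₀(0) = ∑_{k ≤ N} (iᵏ/k!) Jₖ(1) + (i^{N+1}/N!) ∫₀¹ sᴺ J_{N+1}(s) ds` (fundamental
theorem of calculus and `N` integrations by parts on `[0, 1]`; the same computation as
`Literature.Analysis.Distribution.sliceIntegral_zero_eq_sum_add_remainder`, freed of its
specific integrals). [cite: HormanderALPDO1, Thm 3.1.15 eq. (3.1.19)] -/
theorem eq_sum_add_remainder_of_hasDerivAt {J : ℕ → ℝ → ℂ}
    (hD : ∀ k, ∀ s ∈ uIcc (0 : ℝ) 1, HasDerivAt (J k) (-I * J (k + 1) s) s) (N : ℕ) :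
    J 0 0 = ∑ k ∈ Finset.range (N + 1), (I ^ k / k.factorial) * J k 1 +
      (I ^ (N + 1) / N.factorial) * ∫ s in (0 : ℝ)..1, (s : ℂ) ^ N * J (N + 1) s := by
  have hC : ∀ k, ContinuousOn (J k) (uIcc (0 : ℝ) 1) := fun k s hs =>
    (hD k s hs).continuousAt.continuousWithinAt
  have hCI : ∀ k, IntervalIntegrable (fun s => -I * J (k + 1) s) volume 0 1 :=
    fun k => (continuousOn_const.mul (hC (k + 1))).intervalIntegrable
  induction N with
  | zero =>
    have hftc := integral_eq_sub_of_hasDerivAt (hD 0) (hCI 0)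
    simp only [Finset.range_one, Finset.sum_singleton, pow_zero, Nat.factorial_zero, Nat.cast_one,
      div_one, one_mul, zero_add, pow_one]
    rw [intervalIntegral.integral_const_mul] at hftc
    simp only [zero_add] at hftc
    linear_combination hftc
  | succ N ih =>
    set u : ℝ → ℂ := fun s => (s : ℂ) ^ (N + 1) / (N + 1 : ℂ) with hu
    have hN1 : (N + 1 : ℂ) ≠ 0 := by exact_mod_cast Nat.succ_ne_zero N
    have hu' : ∀ s ∈ uIcc (0 : ℝ) 1, HasDerivAt u ((s : ℂ) ^ N) s := by
      intro s _
      have h1 : HasDerivAt (fun z : ℂ => z ^ (N + 1) / (N + 1 : ℂ))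
          (((N + 1 : ℕ) : ℂ) * (s : ℂ) ^ N / (N + 1 : ℂ)) (s : ℂ) :=
        (hasDerivAt_pow (N + 1) (s : ℂ)).div_const _
      have h2 := h1.comp_ofReal
      convert h2 using 1
      push_cast
      field_simp
    have hparts := integral_deriv_mul_eq_sub hu' (hD (N + 1))
      ((Complex.continuous_ofReal.pow N).intervalIntegrable 0 1) (hCI (N + 1))
    have hu1 : u 1 = 1 / (N + 1 : ℂ) := by simp [hu]
    have hu0 : u 0 = 0 := by simp [hu]
    rw [hu1, hu0, zero_mul, sub_zero] at hparts
    have hint1 : IntervalIntegrable (fun s => (s : ℂ) ^ N * J (N + 1) s) volume 0 1 :=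
      ((Complex.continuous_ofReal.pow N).continuousOn.mul (hC (N + 1))).intervalIntegrable
    have hint2 : IntervalIntegrable (fun s => u s * (-I * J (N + 2) s)) volume 0 1 := by
      refine (ContinuousOn.mul ?_ (continuousOn_const.mul (hC (N + 2)))).intervalIntegrable
      exact ((Complex.continuous_ofReal.pow (N + 1)).div_const _).continuousOn
    rw [intervalIntegral.integral_add hint1 hint2] at hparts
    have hrem : ∫ s in (0 : ℝ)..1, (s : ℂ) ^ N * J (N + 1) s =
        1 / (N + 1 : ℂ) * J (N + 1) 1 +
          I / (N + 1 : ℂ) * ∫ s in (0 : ℝ)..1, (s : ℂ) ^ (N + 1) * J (N + 2) s := by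
      have h3 : ∫ s in (0 : ℝ)..1, u s * (-I * J (N + 2) s) =
          -(I / (N + 1 : ℂ)) * ∫ s in (0 : ℝ)..1, (s : ℂ) ^ (N + 1) * J (N + 2) s := by
        rw [← intervalIntegral.integral_const_mul]
        refine intervalIntegral.integral_congr fun s _ => ?_
        simp only [hu]
        field_simp
      rw [h3] at hparts
      linear_combination hparts
    rw [ih, hrem, Finset.sum_range_succ _ (N + 1)]
    have hfac : ((N + 1).factorial : ℂ) = (N + 1 : ℂ) * (N.factorial : ℂ) := by
      rw [Nat.factorial_succ]; push_cast; ring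
    have hfN : (N.factorial : ℂ) ≠ 0 := by exact_mod_cast N.factorial_ne_zero
    rw [hfac]
    field_simp
    ring

/-! ### The pieces of the formula along the reference direction and their limits -/

/-- The ray of `HasTimeRayBoundaryValue` is a slice: `x + (t i) η = x + i (t η)`. [folklore] -/
theorem rayC_ofReal_mul_I (x η : Fin n → SpaceTime d) (t : ℝ) :
    rayC x η ((t : ℂ) * I) = rayC x (t • η) I := by
  rw [rayC, rayC, cpxConfig_smul, smul_smul, mul_comm]

/-- Iterated line derivatives: `∂_Y (∂_Yᵏ F) = ∂_Y^{k+1} F`. [folklore] -/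
theorem lineDerivOp_iterate_succ (Y : Fin n → SpaceTime d) (F : 𝓢((Fin n → SpaceTime d), ℂ)) (k : ℕ) :
    (∂_{Y} ((fun G : 𝓢((Fin n → SpaceTime d), ℂ) => ∂_{Y} G)^[k] F) : 𝓢((Fin n → SpaceTime d), ℂ)) =
      (fun G : 𝓢((Fin n → SpaceTime d), ℂ) => ∂_{Y} G)^[k + 1] F := by
  rw [Function.iterate_succ_apply']

section Pieces

variable {𝔚 : (Fin n → Fin (d + 1) → ℂ) → ℂ} {C : ℝ} {N : ℕ}
  (hGc : ContinuousOn 𝔚 (timeTube d n)) (hGh : IsTimeHolomorphicOn 𝔚 (timeTube d n))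
  (hG : ∀ z ∈ timeTube d n, ‖𝔚 z‖ ≤ C * (1 + ‖z‖) ^ N *
    (1 + ∑ k, ((succDiff (fun j => z j 0) k).im)⁻¹) ^ N)

include hGc hGh hG in
/-- **Hörmander's formula for the slice pairing at height `tη`, `t > 0`**: with
`Jₖ(s) = ∫ 𝔚(x + i(tη + sY)) (∂_Yᵏ F)(x) dx`,
`∫ 𝔚(x + itη) F(x) dx = ∑_{k ≤ M} (iᵏ/k!) Jₖ(1) + (i^{M+1}/M!) ∫₀¹ sᴹ J_{M+1}(s) ds`. [cite: HormanderALPDO1, Thm 3.1.15 eq. (3.1.19)] -/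
theorem integral_rayC_I_eq_sum_add_remainder {η Y : Fin n → SpaceTime d}
    (hη : η ∈ temporalCone d n) (hY : Y ∈ temporalCone d n) {t : ℝ} (ht : 0 < t)
    (F : 𝓢((Fin n → SpaceTime d), ℂ)) (M : ℕ) :
    ∫ x : Fin n → SpaceTime d, 𝔚 (rayC x (t • η) I) * F x =
      ∑ k ∈ Finset.range (M + 1), (I ^ k / k.factorial) *
          (∫ x : Fin n → SpaceTime d, 𝔚 (rayC x (t • η + Y) I) *
            ((fun G : 𝓢((Fin n → SpaceTime d), ℂ) => ∂_{Y} G)^[k] F) x) +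
        (I ^ (M + 1) / M.factorial) * ∫ s in (0 : ℝ)..1, (s : ℂ) ^ M *
          ∫ x : Fin n → SpaceTime d, 𝔚 (rayC x (t • η + s • Y) I) *
            ((fun G : 𝓢((Fin n → SpaceTime d), ℂ) => ∂_{Y} G)^[M + 1] F) x := by
  have hη' := (mem_temporalCone_iff η).1 hη
  have hY' := (mem_temporalCone_iff Y).1 hY
  have htη : ∀ (k : Fin n) (i : Fin d), (t • η) k i.succ = 0 := fun k i => by simp [hη'.1 k i]
  set J : ℕ → ℝ → ℂ := fun k s => ∫ x : Fin n → SpaceTime d, 𝔚 (rayC x (t • η + s • Y) I) *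
    ((fun G : 𝓢((Fin n → SpaceTime d), ℂ) => ∂_{Y} G)^[k] F) x with hJ
  have hmem : ∀ s : ℝ, 0 ≤ s → t • η + s • Y ∈ temporalCone d n := fun s hs =>
    add_smul_mem_temporalCone (smul_mem_temporalCone hη ht) hY'.1 (fun k => (hY'.2 k).le) hs
  have hD : ∀ k, ∀ s ∈ uIcc (0 : ℝ) 1, HasDerivAt (J k) (-I * J (k + 1) s) s := by
    intro k s hs
    rw [uIcc_of_le zero_le_one] at hs
    have h := hasDerivAt_integral_rayC_I_add_smul hGc hGh hG htη hY'.1 (hmem s hs.1)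
      ((fun G : 𝓢((Fin n → SpaceTime d), ℂ) => ∂_{Y} G)^[k] F)
    simp only [hJ, lineDerivOp_iterate_succ] at h ⊢
    exact h
  have h := eq_sum_add_remainder_of_hasDerivAt hD M
  simp only [hJ, zero_smul, add_zero, one_smul, Function.iterate_zero, id_eq] at h
  exact h

include hGc hG in
/-- **Limit of the regular pieces**: for `η, y₀ ∈ T₊`,
`∫ 𝔚(x + i(tη + y₀)) G(x) dx → ∫ 𝔚(x + iy₀) G(x) dx` as `t → 0⁺` (dominated convergence: the heights
`tη + y₀`, `t ∈ [0, 1]`, form a compact subset of `T₊`). [folklore] -/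
theorem tendsto_integral_rayC_I_smul_add {η y₀ : Fin n → SpaceTime d} (hη : η ∈ temporalCone d n)
    (hy₀ : y₀ ∈ temporalCone d n) (G : 𝓢((Fin n → SpaceTime d), ℂ)) :
    Tendsto (fun t : ℝ => ∫ x : Fin n → SpaceTime d, 𝔚 (rayC x (t • η + y₀) I) * G x) (𝓝[>] 0)
      (𝓝 (∫ x : Fin n → SpaceTime d, 𝔚 (rayC x y₀ I) * G x)) := by
  have hη' := (mem_temporalCone_iff η).1 hη
  have hmem : ∀ t : ℝ, 0 ≤ t → t • η + y₀ ∈ temporalCone d n := fun t ht => by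
    rw [add_comm]; exact add_smul_mem_temporalCone hy₀ hη'.1 (fun k => (hη'.2 k).le) ht
  -- the compact set of heights
  set K : Set (Fin n → SpaceTime d) := (fun t : ℝ => t • η + y₀) '' Icc 0 1 with hK
  have hKc : IsCompact K := isCompact_Icc.image ((continuous_id.smul continuous_const).add continuous_const)
  have hKT : K ⊆ temporalCone d n := by rintro _ ⟨t, ht, rfl⟩; exact hmem t ht.1
  obtain ⟨A, -, hA⟩ := exists_norm_apply_rayC_I_le_of_isCompact hG hKc hKT
  have hIoc : Ioc (0 : ℝ) 1 ∈ 𝓝[>] (0 : ℝ) := Ioc_mem_nhdsGT one_pos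
  refine tendsto_integral_mul_of_dominated (μ := volume) (C := A) (N := N) ?_ ?_ ?_ G
  · filter_upwards [self_mem_nhdsWithin] with t (ht : 0 < t)
    exact (continuous_apply_rayC_I hGc (hmem t ht.le)).aestronglyMeasurable
  · filter_upwards [hIoc] with t ht
    exact fun x => hA _ ⟨t, ⟨ht.1.le, ht.2⟩, rfl⟩ x
  · intro x
    refine tendsto_apply_rayC_I hGc ?_ hy₀ ?_ x
    · filter_upwards [self_mem_nhdsWithin] with t (ht : 0 < t) using hmem t ht.le
    · have hc : Continuous fun t : ℝ => t • η + y₀ := (continuous_id.smul continuous_const).add continuous_const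
      have h := hc.tendsto 0
      simp only [zero_smul, zero_add] at h
      exact h.mono_left nhdsWithin_le_nhds

include hGc hG in
/-- **Uniform bound for the remainder integrand**: for `η, Y ∈ T₊` there are finitely many Schwartz
seminorms and a constant controlling `sᴺ ∫ 𝔚(x + i(tη + sY)) G(x) dx` for all `0 ≤ t ≤ 1`,
`0 < s ≤ 1` and all `G` (edge estimate + uniform temperedness). [folklore] -/
theorem exists_norm_pow_mul_integral_le {η Y : Fin n → SpaceTime d} (hη : η ∈ temporalCone d n)
    (hY : Y ∈ temporalCone d n) :
    ∃ (s' : Finset (ℕ × ℕ)) (C' : ℝ), 0 ≤ C' ∧ ∀ t : ℝ, 0 ≤ t → t ≤ 1 → ∀ s : ℝ, 0 < s → s ≤ 1 →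
      ∀ G : 𝓢((Fin n → SpaceTime d), ℂ),
        ‖(s : ℂ) ^ N * ∫ x : Fin n → SpaceTime d, 𝔚 (rayC x (t • η + s • Y) I) * G x‖ ≤
          C' * (s'.sup (schwartzSeminormFamily ℂ (Fin n → SpaceTime d) ℂ)) G := by
  obtain ⟨A, -, hA⟩ := pow_mul_norm_apply_rayC_I_le hG hη hY
  obtain ⟨s', C', hC', hb⟩ := exists_norm_integral_mul_le_seminorm
    (volume : Measure (Fin n → SpaceTime d)) A N
  refine ⟨s', C', hC', fun t ht ht1 s hs hs1 G => ?_⟩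
  have hmem := smul_add_smul_mem_temporalCone hη hY ht hs
  rw [← MeasureTheory.integral_const_mul]
  have h := hb (fun x => (s : ℂ) ^ N * 𝔚 (rayC x (t • η + s • Y) I))
    (((continuous_apply_rayC_I hGc hmem).const_smul ((s : ℂ) ^ N)).aestronglyMeasurable)
    (fun x => by
      rw [norm_mul, Complex.norm_pow, Complex.norm_real, Real.norm_eq_abs, abs_of_pos hs]
      exact hA t ht ht1 s hs hs1 x) G
  refine le_trans (le_of_eq ?_) h
  congr 1
  refine integral_congr_ae (Eventually.of_forall fun x => ?_)
  simp only; ring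

include hGc hGh hG in
/-- **Limit of the remainder**: for `η, Y ∈ T₊`,
`∫₀¹ sᴺ ∫ 𝔚(x + i(tη + sY)) G dx ds → ∫₀¹ sᴺ ∫ 𝔚(x + isY) G dx ds` as `t → 0⁺` (dominated convergence
on `(0, 1]` with the constant majorant of `exists_norm_pow_mul_integral_le`). [cite: HormanderALPDO1, Thm 3.1.15 proof] -/
theorem tendsto_remainder {η Y : Fin n → SpaceTime d} (hη : η ∈ temporalCone d n)
    (hY : Y ∈ temporalCone d n) (G : 𝓢((Fin n → SpaceTime d), ℂ)) :
    Tendsto (fun t : ℝ => ∫ s in (0 : ℝ)..1, (s : ℂ) ^ N *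
        ∫ x : Fin n → SpaceTime d, 𝔚 (rayC x (t • η + s • Y) I) * G x) (𝓝[>] 0)
      (𝓝 (∫ s in (0 : ℝ)..1, (s : ℂ) ^ N *
        ∫ x : Fin n → SpaceTime d, 𝔚 (rayC x (s • Y) I) * G x)) := by
  have hη' := (mem_temporalCone_iff η).1 hη
  have hY' := (mem_temporalCone_iff Y).1 hY
  obtain ⟨s', C', -, hb⟩ := exists_norm_pow_mul_integral_le hGc hG hη hY
  set S : ℝ := (s'.sup (schwartzSeminormFamily ℂ (Fin n → SpaceTime d) ℂ)) G with hS
  have hIoc : Ioc (0 : ℝ) 1 ∈ 𝓝[>] (0 : ℝ) := Ioc_mem_nhdsGT one_pos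
  refine intervalIntegral.tendsto_integral_filter_of_dominated_convergence (fun _ => C' * S) ?_ ?_ ?_ ?_
  · -- measurability: continuity in `s` on `[0, 1]` for `t > 0`
    filter_upwards [self_mem_nhdsWithin] with t (ht : 0 < t)
    have htη : ∀ (k : Fin n) (i : Fin d), (t • η) k i.succ = 0 := fun k i => by simp [hη'.1 k i]
    have hc : ContinuousOn (fun s : ℝ => (s : ℂ) ^ N *
        ∫ x : Fin n → SpaceTime d, 𝔚 (rayC x (t • η + s • Y) I) * G x) (Icc 0 1) := by
      intro s hs
      refine ((Complex.continuous_ofReal.pow N).continuousAt.mul ?_).continuousWithinAt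
      exact continuousAt_integral_rayC_I_add_smul hGc hGh hG htη hY'.1
        (add_smul_mem_temporalCone (smul_mem_temporalCone hη ht) hY'.1 (fun k => (hY'.2 k).le) hs.1) G
    rw [uIoc_of_le zero_le_one]
    exact (hc.mono Ioc_subset_Icc_self).aestronglyMeasurable measurableSet_Ioc
  · filter_upwards [hIoc] with t ht
    refine Eventually.of_forall fun s hs => ?_
    rw [uIoc_of_le zero_le_one] at hs
    exact hb t ht.1.le ht.2 s hs.1 hs.2 G
  · exact intervalIntegrable_const
  · refine Eventually.of_forall fun s hs => ?_
    rw [uIoc_of_le zero_le_one] at hs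
    exact (tendsto_integral_rayC_I_smul_add hGc hG hη (smul_mem_temporalCone hY hs.1) G).const_mul _

include hGc hGh hG in
/-- **The remainder functional is tempered**: for `Y ∈ T₊`,
`G ↦ ∫₀¹ sᴺ ∫ 𝔚(x + isY) G(x) dx ds` is a continuous linear functional on `𝓢` (the integrand is
continuous on `(0, 1]` and bounded by finitely many seminorms of `G`). [cite: HormanderALPDO1, Thm 3.1.15 eq. (3.1.20)] -/
theorem exists_clm_remainder {Y : Fin n → SpaceTime d} (hY : Y ∈ temporalCone d n) :
    ∃ R : 𝓢((Fin n → SpaceTime d), ℂ) →L[ℂ] ℂ, ∀ G, R G = ∫ s in (0 : ℝ)..1, (s : ℂ) ^ N *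
      ∫ x : Fin n → SpaceTime d, 𝔚 (rayC x (s • Y) I) * G x := by
  have hY' := (mem_temporalCone_iff Y).1 hY
  obtain ⟨s', C', hC', hb⟩ := exists_norm_pow_mul_integral_le hGc hG hY hY
  -- the integrand and its properties
  set Φ : 𝓢((Fin n → SpaceTime d), ℂ) → ℝ → ℂ := fun G s => (s : ℂ) ^ N *
    ∫ x : Fin n → SpaceTime d, 𝔚 (rayC x (s • Y) I) * G x with hΦ
  have h0 : ∀ (k : Fin n) (i : Fin d), (0 : Fin n → SpaceTime d) k i.succ = 0 := fun k i => rfl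
  have hbd : ∀ G, ∀ s ∈ Ioc (0 : ℝ) 1,
      ‖Φ G s‖ ≤ C' * (s'.sup (schwartzSeminormFamily ℂ (Fin n → SpaceTime d) ℂ)) G := by
    intro G s hs
    have h := hb 0 le_rfl zero_le_one s hs.1 hs.2 G
    simpa [hΦ] using h
  have hcont : ∀ G, ContinuousOn (Φ G) (Ioc 0 1) := by
    intro G s hs
    refine ((Complex.continuous_ofReal.pow N).continuousAt.mul ?_).continuousWithinAt
    have h := continuousAt_integral_rayC_I_add_smul hGc hGh hG h0 hY'.1 (s₀ := s)
      (by simpa using smul_mem_temporalCone hY hs.1) G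
    simpa using h
  have hint : ∀ G, IntervalIntegrable (Φ G) volume 0 1 := by
    intro G
    rw [intervalIntegrable_iff_integrableOn_Ioc_of_le zero_le_one]
    have hconst : IntegrableOn (fun _ : ℝ => C' * (s'.sup (schwartzSeminormFamily ℂ
        (Fin n → SpaceTime d) ℂ)) G) (Ioc 0 1) volume :=
      (intervalIntegrable_iff_integrableOn_Ioc_of_le zero_le_one).1 intervalIntegrable_const
    refine Integrable.mono' hconst ((hcont G).aestronglyMeasurable measurableSet_Ioc) ?_
    exact (ae_restrict_iff' measurableSet_Ioc).2 (Eventually.of_forall fun s hs => hbd G s hs)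
  refine ⟨SchwartzMap.mkCLMtoNormedSpace (𝕜 := ℂ) (𝕜' := ℂ) (σ := RingHom.id ℂ)
    (fun G => ∫ s in (0 : ℝ)..1, Φ G s) (fun G₁ G₂ => ?_) (fun a G => ?_) ⟨s', C', hC', fun G => ?_⟩,
    fun G => rfl⟩
  · -- additivity (a.e. on `(0, 1]`, where the slices are integrable)
    rw [← intervalIntegral.integral_add (hint G₁) (hint G₂)]
    refine intervalIntegral.integral_congr_ae (Eventually.of_forall fun s hs => ?_)
    rw [uIoc_of_le zero_le_one] at hs
    have hmem : s • Y ∈ temporalCone d n := smul_mem_temporalCone hY hs.1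
    simp only [hΦ, add_apply, mul_add]
    rw [integral_add (integrable_apply_rayC_I_mul hGc hG hmem G₁)
      (integrable_apply_rayC_I_mul hGc hG hmem G₂)]
    ring
  · simp only [hΦ, smul_apply, smul_eq_mul, RingHom.id_apply]
    rw [← intervalIntegral.integral_const_mul]
    refine intervalIntegral.integral_congr fun s _ => ?_
    have h1 : ∫ x : Fin n → SpaceTime d, 𝔚 (rayC x (s • Y) I) * (a * G x) =
        a * ∫ x : Fin n → SpaceTime d, 𝔚 (rayC x (s • Y) I) * G x := by
      rw [← MeasureTheory.integral_const_mul]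
      refine integral_congr_ae (Eventually.of_forall fun x => ?_)
      simp only; ring
    simp only [h1]
    ring
  · have h := intervalIntegral.norm_integral_le_of_norm_le_const (a := (0 : ℝ)) (b := 1)
      (f := Φ G) (C := C' * (s'.sup (schwartzSeminormFamily ℂ (Fin n → SpaceTime d) ℂ)) G)
      (fun s hs => hbd G s (by rwa [uIoc_of_le zero_le_one] at hs))
    simpa using h

include hGc hGh hG in
/-- **Existence of the boundary value, with Hörmander's formula (3.1.20) for it**: for a reference
direction `Y ∈ T₊` there is a continuous linear functional `T` on `𝓢` such that for EVERY
`η ∈ T₊` and every Schwartz `F`, `∫ 𝔚(x + itη) F(x) dx → T(F)` as `t → 0⁺`; explicitly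
`T(F) = ∑_{k ≤ N} (iᵏ/k!) ∫ 𝔚(x + iY) ∂_Yᵏ F + (i^{N+1}/N!) ∫₀¹ sᴺ ∫ 𝔚(x + isY) ∂_Y^{N+1} F`.
[cite: HormanderALPDO1, Thm 3.1.15 eq. (3.1.20)] -/
theorem exists_clm_tendsto_integral_rayC_I_of_mem {Y : Fin n → SpaceTime d}
    (hY : Y ∈ temporalCone d n) :
    ∃ T : 𝓢((Fin n → SpaceTime d), ℂ) →L[ℂ] ℂ, ∀ η ∈ temporalCone d n,
      ∀ F : 𝓢((Fin n → SpaceTime d), ℂ),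
        Tendsto (fun t : ℝ => ∫ x : Fin n → SpaceTime d, 𝔚 (rayC x (t • η) I) * F x) (𝓝[>] 0)
          (𝓝 (T F)) := by
  obtain ⟨L, hL⟩ := exists_clm_integral_mul (μ := (volume : Measure (Fin n → SpaceTime d)))
    (continuous_apply_rayC_I hGc hY).aestronglyMeasurable (norm_apply_rayC_I_le hG hY)
  obtain ⟨R, hR⟩ := exists_clm_remainder hGc hGh hG hY
  set D : 𝓢((Fin n → SpaceTime d), ℂ) →L[ℂ] 𝓢((Fin n → SpaceTime d), ℂ) :=
    LineDeriv.lineDerivOpCLM ℂ 𝓢((Fin n → SpaceTime d), ℂ) Y with hD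
  have hDk : ∀ (k : ℕ) (G : 𝓢((Fin n → SpaceTime d), ℂ)),
      (D ^ k) G = (fun G : 𝓢((Fin n → SpaceTime d), ℂ) => ∂_{Y} G)^[k] G := by
    intro k G
    rw [ContinuousLinearMap.coe_pow']
    rfl
  set T : 𝓢((Fin n → SpaceTime d), ℂ) →L[ℂ] ℂ :=
    ∑ k ∈ Finset.range (N + 1), (I ^ k / k.factorial) • (L ∘L (D ^ k)) +
      (I ^ (N + 1) / N.factorial) • (R ∘L (D ^ (N + 1))) with hT
  refine ⟨T, fun η hη F => ?_⟩
  have hTF : T F = ∑ k ∈ Finset.range (N + 1), (I ^ k / k.factorial) *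
      (∫ x : Fin n → SpaceTime d, 𝔚 (rayC x Y I) *
        ((fun G : 𝓢((Fin n → SpaceTime d), ℂ) => ∂_{Y} G)^[k] F) x) +
      (I ^ (N + 1) / N.factorial) * ∫ s in (0 : ℝ)..1, (s : ℂ) ^ N *
        ∫ x : Fin n → SpaceTime d, 𝔚 (rayC x (s • Y) I) *
          ((fun G : 𝓢((Fin n → SpaceTime d), ℂ) => ∂_{Y} G)^[N + 1] F) x := by
    simp [hT, hDk, hL, hR]
  rw [hTF]
  have hev : ∀ᶠ t : ℝ in 𝓝[>] 0, ∫ x : Fin n → SpaceTime d, 𝔚 (rayC x (t • η) I) * F x =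
      ∑ k ∈ Finset.range (N + 1), (I ^ k / k.factorial) *
          (∫ x : Fin n → SpaceTime d, 𝔚 (rayC x (t • η + Y) I) *
            ((fun G : 𝓢((Fin n → SpaceTime d), ℂ) => ∂_{Y} G)^[k] F) x) +
        (I ^ (N + 1) / N.factorial) * ∫ s in (0 : ℝ)..1, (s : ℂ) ^ N *
          ∫ x : Fin n → SpaceTime d, 𝔚 (rayC x (t • η + s • Y) I) *
            ((fun G : 𝓢((Fin n → SpaceTime d), ℂ) => ∂_{Y} G)^[N + 1] F) x := by
    filter_upwards [self_mem_nhdsWithin] with t (ht : 0 < t)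
    exact integral_rayC_I_eq_sum_add_remainder hGc hGh hG hη hY ht F N
  refine Tendsto.congr' (EventuallyEq.symm hev) ?_
  refine Tendsto.add (tendsto_finsetSum _ fun k _ => Tendsto.const_mul _ ?_) (Tendsto.const_mul _ ?_)
  · exact tendsto_integral_rayC_I_smul_add hGc hG hη hY _
  · exact tendsto_remainder hGc hGh hG hη hY _

end Pieces

/-! ### The boundary value -/

/-- **Existence of the tempered time-ray boundary value** (Osterwalder–Schrader II (1975), §IV.2
p. 289 / Vladimirov §26 / Hörmander Thm. 3.1.15, for a function continuous on the time tube,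
holomorphic in the times and of OS growth): there is a continuous linear functional `T` on
`𝓢((ℝ^{1+d})ⁿ)` with `∫ 𝔚(x + itη) F(x) dx → T(F)` as `t → 0⁺` for every `η` in the temporal cone
and every Schwartz `F`; in particular `HasTimeRayBoundaryValue 𝔚 T`. [cite: OsterwalderSchraderCMP1975, §IV.2 p. 289 (4.7)] -/
theorem exists_clm_tendsto_integral_rayC_I {𝔚 : (Fin n → Fin (d + 1) → ℂ) → ℂ}
    (hGc : ContinuousOn 𝔚 (timeTube d n)) (hGh : IsTimeHolomorphicOn 𝔚 (timeTube d n))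
    (hW : HasOSGrowth 𝔚) :
    ∃ T : 𝓢((Fin n → SpaceTime d), ℂ) →L[ℂ] ℂ, HasTimeRayBoundaryValue 𝔚 T ∧
      ∀ η ∈ temporalCone d n, ∀ F : 𝓢((Fin n → SpaceTime d), ℂ),
        Tendsto (fun t : ℝ => ∫ x : Fin n → SpaceTime d, 𝔚 (rayC x (t • η) I) * F x) (𝓝[>] 0)
          (𝓝 (T F)) := by
  obtain ⟨C, N, hG⟩ := hW
  obtain ⟨T, hT⟩ := exists_clm_tendsto_integral_rayC_I_of_mem hGc hGh hG
    (stdDirection_mem_temporalCone (d := d) (n := n))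
  refine ⟨T, fun η hη F => ?_, hT⟩
  refine (hT η hη F).congr fun t => ?_
  refine integral_congr_ae (Eventually.of_forall fun x => ?_)
  simp only
  rw [← rayC_ofReal_mul_I]
  rfl

/-- **Vanishing slice pairings give a vanishing boundary value**: if `T` is the time-ray limit and
`∫ 𝔚(x + iy) F(x) dx = 0` for all `y ∈ T₊`, then `T F = 0`. [folklore] -/
theorem apply_eq_zero_of_forall_integral_rayC_I_eq_zero {𝔚 : (Fin n → Fin (d + 1) → ℂ) → ℂ}
    {T : 𝓢((Fin n → SpaceTime d), ℂ) →L[ℂ] ℂ}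
    (hT : ∀ η ∈ temporalCone d n, ∀ F : 𝓢((Fin n → SpaceTime d), ℂ),
      Tendsto (fun t : ℝ => ∫ x : Fin n → SpaceTime d, 𝔚 (rayC x (t • η) I) * F x) (𝓝[>] 0)
        (𝓝 (T F)))
    {F : 𝓢((Fin n → SpaceTime d), ℂ)}
    (hF : ∀ y ∈ temporalCone d n, ∫ x : Fin n → SpaceTime d, 𝔚 (rayC x y I) * F x = 0) :
    T F = 0 := by
  set η : Fin n → SpaceTime d := fun k => (((k : ℕ) : ℝ) + 1) • e₀ d with hη
  have hηT : η ∈ temporalCone d n := stdDirection_mem_temporalCone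
  have h := hT η hηT F
  have h0 : Tendsto (fun t : ℝ => ∫ x : Fin n → SpaceTime d, 𝔚 (rayC x (t • η) I) * F x) (𝓝[>] 0)
      (𝓝 0) := by
    refine tendsto_const_nhds.congr' ?_
    filter_upwards [self_mem_nhdsWithin] with t (ht : 0 < t)
    exact (hF _ (smul_mem_temporalCone hηT ht)).symm
  exact tendsto_nhds_unique h h0

/-- **Translation invariance of `𝔚` kills diagonal derivatives under the boundary value**:
`T(∂_â F) = 0` for every real `a`, `â = (a, …, a)`. [folklore] -/
theorem apply_lineDerivOp_diag_eq_zero {𝔚 : (Fin n → Fin (d + 1) → ℂ) → ℂ}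
    (hGc : ContinuousOn 𝔚 (timeTube d n)) (hW : HasOSGrowth 𝔚)
    (htr : ∀ z ∈ timeTube d n, ∀ a : SpaceTime d, 𝔚 (fun k => z k + complexifyPoint a) = 𝔚 z)
    {T : 𝓢((Fin n → SpaceTime d), ℂ) →L[ℂ] ℂ}
    (hT : ∀ η ∈ temporalCone d n, ∀ F : 𝓢((Fin n → SpaceTime d), ℂ),
      Tendsto (fun t : ℝ => ∫ x : Fin n → SpaceTime d, 𝔚 (rayC x (t • η) I) * F x) (𝓝[>] 0)
        (𝓝 (T F)))
    (a : SpaceTime d) (F : 𝓢((Fin n → SpaceTime d), ℂ)) :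
    T (∂_{(fun _ : Fin n => a)} F) = 0 := by
  obtain ⟨C, N, hG⟩ := hW
  exact apply_eq_zero_of_forall_integral_rayC_I_eq_zero hT fun y hy =>
    integral_rayC_I_mul_lineDerivOp_diag_eq_zero hGc hG htr hy a F

end Literature.MathematicalPhysics.QuantumFieldTheory
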